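import Summits.CriticalPhenomena.Ising3DConformalLimit.Theses.MonotoneRG
import Summits.CriticalPhenomena.Ising3DConformalLimit.Theses.MirrorHoelderCompactness
import Summits.CriticalPhenomena.Ising3DConformalLimit.Theorems.ExistsScaleCovariantLimit.Negative.TightnessUniqueness
import Summits.CriticalPhenomena.Ising3DConformalLimit.Theorems.MoebiusLimitExists.Negative.LocalBoundsDoubling
import HarnessLib

/-!
# `OrbitPrecompact` (item stmt-CriticalPhenomena-5955) ⟹ `TwoPointDoubling` (item stmt-CriticalPhenomena-6150)
(line `Sketch` of the crux `ExistsScaleCovariantLimit`, item stmt-CriticalPhenomena-1981;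
stub `stub_twoPointDoubling_of_orbitPrecompact`, glue D)

The tightness half of the crux already contains the open lattice statement "all-scale axis doubling"
`κ g(n) ≤ g(2n)` of the axial critical two-point function `g(m) = ⟨σ₀σ_{m e₀}⟩_{β_c}` on `ℤ³`
(`g m = criticalTwoPoint 3 (Pi.single 0 m)`), so the compactness items line up as 5955 ⟹ 6150.

Mechanism. `tight_of_orbitPrecompact`: `OrbitPrecompact` gives TIGHTNESS of the pinned zoom
`F_n(δ) = rescaledCorrelator (criticalCorr 3) rhoPin n δ` (every mesh sequence in `(0,1]` tending to
`0⁺` has a subsequence along which `F_n` converges locally uniformly off the diagonals, all `n`).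
Tightness forces the values `F_n(u_k)(x)` along any admissible mesh sequence `u` at any non-coincident
`x` to be eventually bounded above (`eventually_le_of_tight`: otherwise extract `u ∘ φ` with
`F_n(u (φ j))(x) > j`; a convergent sub-subsequence at `x` is absurd). At the axis pair
`x = (0, e₀/2)` and the meshes `u_k = (1/2)/(k+1)` the pinned zoom IS the two-point ratio
`g(k+1)/g(2(k+1))` (`rescaled_pin_cfg0s`: `⌊(1/2)/u_k⌋ = k+1`, `⌊1/u_k⌋ = 2(k+1)`), so
`g(n)/g(2n) ≤ B` for all large `n`; an eventually bounded real sequence is bounded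
(`Filter.IsBoundedUnder.bddAbove_range`), and `κ := (max B' 1)⁻¹` works for every `n`, by positivity
of `g` (`criticalTwoPoint_pos3`). No named facts. [folklore]
-/

noncomputable section

namespace Summit.CriticalPhenomena.Ising3DConformalLimit.Cruxes.ExistsScaleCovariantLimit.TwoHierarchies

open Literature.Probability.LatticeModels Filter Set
open scoped Topology
open Summit.CriticalPhenomena.Ising3DConformalLimit.MoebiusLimitExistsOnlyInteraction (rhoPin)
open Summit.CriticalPhenomena.Ising3DConformalLimit.MoebiusLimitExistsNegative
  (rescaled_pin_cfg0s tendsto_div_succ_nhdsGT)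
open Summit.CriticalPhenomena.Ising3DConformalLimit.PinnedClusterPoints (criticalTwoPoint_pos3)
open Summit.CriticalPhenomena.Ising3DConformalLimit.ExistsScaleCovariantLimitNegative
  (tight_of_orbitPrecompact)

/-- **Tightness ⟹ sequential eventual upper bounds of the pinned zoom.** If every admissible mesh
sequence has a subsequence along which the pinned zoom converges locally uniformly off the diagonals,
then along every admissible mesh sequence `u` and at every non-coincident configuration `x` the
values `F_n(u k)(x)` are eventually bounded above (if `F_n(u (φ j))(x) > j` along a subsequence, no
sub-subsequence could converge at `x`). -- adapted from Cruxes/ExistsScaleCovariantLimit/Disproof.lean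
§K `axisRatio_bounded_of_pinnedPrecompact`. [folklore] -/
theorem eventually_le_of_tight
    (htight : ∀ u : ℕ → ℝ, (∀ k, u k ∈ Set.Ioc (0:ℝ) 1) → Tendsto u atTop (𝓝[>] (0:ℝ)) →
      ∃ φ : ℕ → ℕ, StrictMono φ ∧ ∃ S : CorrFamily 3, ∀ n,
        TendstoLocallyUniformlyOn (fun k => rescaledCorrelator (criticalCorr 3) rhoPin n (u (φ k)))
          (S n) atTop (NonCoincident 3 n))
    {u : ℕ → ℝ} (hu1 : ∀ k, u k ∈ Set.Ioc (0:ℝ) 1) (hut : Tendsto u atTop (𝓝[>] (0:ℝ)))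
    {n : ℕ} {x : Fin n → EuclideanSpace ℝ (Fin 3)} (hx : x ∈ NonCoincident 3 n) :
    ∃ B : ℝ, ∀ᶠ k in atTop, rescaledCorrelator (criticalCorr 3) rhoPin n (u k) x ≤ B := by
  by_contra hnot
  rw [not_exists] at hnot
  -- for every `m`, frequently `m < F_n(u k)(x)`; extract a subsequence
  have hfreq : ∀ m : ℕ, ∃ᶠ k in atTop, (m:ℝ) < rescaledCorrelator (criticalCorr 3) rhoPin n (u k) x :=
    fun m => (Filter.not_eventually.1 (hnot m)).mono fun k hk => not_le.1 hk
  obtain ⟨φ, hφ, hφr⟩ := Filter.extraction_forall_of_frequently hfreq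
  -- tightness along the admissible sequence `u ∘ φ`
  obtain ⟨ψ, hψ, S, hS⟩ :=
    htight (fun j => u (φ j)) (fun j => hu1 (φ j)) (hut.comp hφ.tendsto_atTop)
  have hconv : Tendsto (fun j => rescaledCorrelator (criticalCorr 3) rhoPin n (u (φ (ψ j))) x) atTop
      (𝓝 (S n x)) := (hS n).tendsto_at hx
  have hev : ∀ᶠ j in atTop, rescaledCorrelator (criticalCorr 3) rhoPin n (u (φ (ψ j))) x < S n x + 1 :=
    hconv.eventually (Iio_mem_nhds (lt_add_one _))
  obtain ⟨N, hN⟩ := exists_nat_gt (S n x + 1)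
  obtain ⟨j, hj1, hj2⟩ := (hev.and (eventually_ge_atTop N)).exists
  have h1 : ((ψ j : ℕ) : ℝ) < rescaledCorrelator (criticalCorr 3) rhoPin n (u (φ (ψ j))) x := hφr (ψ j)
  have h2 : (j:ℝ) ≤ ((ψ j : ℕ) : ℝ) := by exact_mod_cast hψ.id_le j
  have h3 : (N:ℝ) ≤ (j:ℝ) := by exact_mod_cast hj2
  linarith

/-- **D — glue: item stmt-CriticalPhenomena-5955 `OrbitPrecompact` gives item
stmt-CriticalPhenomena-6150 `TwoPointDoubling`** (all-scale axis doubling `κ g(n) ≤ g(2n)`): tightness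
of the pinned zoom (`tight_of_orbitPrecompact`) gives eventual boundedness (`eventually_le_of_tight`)
at the pair `(0, e₀/2)` along the meshes `(1/2)/(k+1)`, where the pinned zoom is EXACTLY
`g(k+1)/g(2(k+1))` (`rescaled_pin_cfg0s`); so `g(n)/g(2n) ≤ B` for `n` large, hence for all `n`
(`Filter.IsBoundedUnder.bddAbove_range`), and `κ := (max B' 1)⁻¹` works by positivity of `g`
(`criticalTwoPoint_pos3`). [folklore] -/
theorem stub_twoPointDoubling_of_orbitPrecompact :
    Summit.CriticalPhenomena.Ising3DConformalLimit.Theses.MonotoneRG.OrbitPrecompact →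
    Summit.CriticalPhenomena.Ising3DConformalLimit.Theses.MirrorHoelderCompactness.TwoPointDoubling := by
  intro hpc
  have htight := tight_of_orbitPrecompact hpc
  -- the admissible mesh sequence `(1/2)/(k+1)` and the axis pair `(0, e₀/2)`
  have hu1 : ∀ k : ℕ, (1/2 : ℝ) / ((k:ℝ) + 1) ∈ Set.Ioc (0:ℝ) 1 := by
    intro k
    constructor
    · positivity
    · rw [div_le_one (by positivity)]; linarith [k.cast_nonneg (α := ℝ)]
  have hut : Tendsto (fun k : ℕ => (1/2 : ℝ) / ((k:ℝ) + 1)) atTop (𝓝[>] (0:ℝ)) :=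
    tendsto_div_succ_nhdsGT (by norm_num)
  have hx : (![0, EuclideanSpace.single 0 (1/2 : ℝ)] : Fin 2 → EuclideanSpace ℝ (Fin 3)) ∈
      NonCoincident 3 2 := zero_unitVec_mem_nonCoincident (by norm_num)
  obtain ⟨B, hB⟩ := eventually_le_of_tight htight hu1 hut hx
  -- the pinned zoom there is the two-point ratio `g(k+1)/g(2(k+1))`
  have hr_eq : ∀ k : ℕ, rescaledCorrelator (criticalCorr 3) rhoPin 2 ((1/2 : ℝ) / ((k:ℝ) + 1))
      (![0, EuclideanSpace.single 0 (1/2 : ℝ)] : Fin 2 → EuclideanSpace ℝ (Fin 3)) =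
      criticalTwoPoint 3 (Pi.single 0 (((k + 1 : ℕ)) : ℤ)) /
        criticalTwoPoint 3 (Pi.single 0 (2 * (((k + 1 : ℕ)) : ℤ))) := by
    intro k
    rw [rescaled_pin_cfg0s]
    have e1 : (1/2 : ℝ) / ((1/2 : ℝ) / ((k:ℝ) + 1)) = ((k + 1 : ℕ) : ℝ) := by
      push_cast; field_simp
    have e2 : (1 : ℝ) / ((1/2 : ℝ) / ((k:ℝ) + 1)) = ((2 * ((k + 1 : ℕ) : ℤ) : ℤ) : ℝ) := by
      push_cast; field_simp
    rw [e1, e2, Int.floor_natCast, Int.floor_intCast]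
  -- the ratio `q n = g(n)/g(2n)` is eventually, hence everywhere, bounded above
  set q : ℕ → ℝ := fun n => criticalTwoPoint 3 (Pi.single 0 (n : ℤ)) /
    criticalTwoPoint 3 (Pi.single 0 (2 * (n : ℤ))) with hq
  have hqev : ∀ᶠ n in atTop, q n ≤ B := by
    obtain ⟨N, hN⟩ := eventually_atTop.1 hB
    refine eventually_atTop.2 ⟨N + 1, fun n hn => ?_⟩
    obtain ⟨k, rfl⟩ : ∃ k, n = k + 1 := ⟨n - 1, by omega⟩
    have h := hN k (by omega)
    rw [hr_eq k] at h
    exact h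
  obtain ⟨B', hB'⟩ := (Filter.isBoundedUnder_of_eventually_le hqev).bddAbove_range
  have hqle : ∀ n : ℕ, q n ≤ max B' 1 := fun n => (hB' ⟨n, rfl⟩).trans (le_max_left _ _)
  have hMpos : 0 < max B' 1 := lt_of_lt_of_le one_pos (le_max_right _ _)
  refine ⟨(max B' 1)⁻¹, inv_pos.2 hMpos, fun n _ => ?_⟩
  have hg2 : 0 < criticalTwoPoint 3 (Pi.single 0 (2 * (n : ℤ))) := criticalTwoPoint_pos3 _
  have h1 : criticalTwoPoint 3 (Pi.single 0 (n : ℤ)) ≤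
      max B' 1 * criticalTwoPoint 3 (Pi.single 0 (2 * (n : ℤ))) := by
    have := hqle n
    rw [hq, div_le_iff₀ hg2] at this
    exact this
  rwa [inv_mul_le_iff₀ hMpos]

end Summit.CriticalPhenomena.Ising3DConformalLimit.Cruxes.ExistsScaleCovariantLimit.TwoHierarchies

end
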